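import Summits.ResolutionOfSingularities.ResolutionOfSingularities.Theorems.FrobeniusClosingPatchingRelPerfectDepthMultiHostCJSTransportStep
import Literature.AlgebraicGeometry.Resolution.NormalCrossingsLocal
import Literature.AlgebraicGeometry.Resolution.BlowupRestrictOpen
import Literature.AlgebraicGeometry.Resolution.MonomialOrderReductionUnit
import Literature.RingTheory.HilbertSamuel.NormalFlatnessLocalization
import HarnessLib

/-!
# Crux `PatchingRelPerfect` (stmt-ResolutionOfSingularities-16161), chain W5.2 — F7(β) (β-AX) T2b-X (targets v7):
# TRANSPORT OF THE CJS STEP DATA (singular-or-boundary, permissibility) along isomorphisms and blow-ups off their centre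

[OURS · L1 W5.2 · F7(β) (β-AX) T2b-X (res-L1-w52-plan-1 g12 RULING G12-1 / NOTE G12-2: targets v7 thread the CJS fields `hBsing` /
`hperm` of `IsBPermissibleSequenceB.blowup`, in cylinder-state currency, through the step-stable predicate)] Fact-free; def-free; NOT
statements of the manuscript under review (Hironaka 2017); AI-written, weaker than expert review.

The CJS data of a centre are POINTWISE statements about the local ring of the (reduced) strict transform `D` at the points of the
centre: «`𝒪_{Z,x}/𝓘(D)_x` is not regular, or `x` is a boundary point» and «`𝓘(C)_x · (𝒪_{Z,x}/𝓘(D)_x)` is permissible (CJS Def. 3.1)».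
They travel (i) along an isomorphism of carriers (the transport΄s `e : cyl.Z ≅ Z_k`), (ii) along the blowing up of an EARLIER piece
of the same centre, an isomorphism near the later pieces.  Both are «a morphism whose stalk map at the point is an isomorphism», and
the only geometric input is that the relevant ideal sheaves upstairs are, near the point, the pull-backs of those downstairs.

* `isPermissible_map_quotient_of_ringEquiv`, `not_isRegularLocalRing_quotient_of_ringEquiv` — ring level.
* `isPermissible_stalk_comap`, `not_isRegularLocalRing_stalk_comap` — along `f` at a point where `f.stalkMap` is an isomorphism,
  for the pulled-back ideal sheaves.
* `stalkIdeal_vanishingIdeal_eq_comap_of_not_mem` — for a blowing up `τ` along `C` and a point `x′` off `τ⁻¹V(C)`: a closed `T′`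
  upstairs agreeing with `τ⁻¹T` off `τ⁻¹V(C)` has `𝓘(T′)_{x′} = (τ^*𝓘(T))_{x′}`.
* `closure_preimage_closure_diff` — the closure calculus of iterated strict transforms: `cl ρ⁻¹(cl A ∖ V(C)) = cl ρ⁻¹(A ∖ V(C))` for a
  blowing up `ρ` along `C`.

## References
* V. Cossart, U. Jannsen, S. Saito, LNM 2270 (2020), Def. 3.1, Thm. 6.9 (a), (6.2). [CossartJannsenSaito2020]
* U. Görtz, T. Wedhorn, *Algebraic Geometry I* (2020), Prop. 13.91 (3). [GortzWedhorn2020]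
* The Stacks Project, Tag 02OS. [StacksProject]
-/

-- `Summit.<Summit>.<Sub>.Theorems` with `Sub = Summit` (single-conjunct summit, D-0017)
set_option linter.dupNamespace false

noncomputable section

open CategoryTheory CategoryTheory.Limits AlgebraicGeometry TopologicalSpace IsLocalRing
open Literature.AlgebraicGeometry.Resolution Scheme.IdealSheafData

namespace Summit.ResolutionOfSingularities.ResolutionOfSingularities.Theorems

universe u

namespace MultiHostCJS

/-! ## §1 Ring level -/

/-- **Permissibility of `I · (R/J)` travels along a ring isomorphism `φ : R ≃ S`** (to `φ(I) · (S/φ(J))`).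
[cite: CossartJannsenSaito2020, Def. 3.1 (2)] -/
theorem isPermissible_map_quotient_of_ringEquiv {R S : Type u} [CommRing R] [CommRing S] (φ : R ≃+* S) {φ' : R →+* S}
    (hφ : (φ : R →+* S) = φ') {I J : Ideal R} (h : (I.map (Ideal.Quotient.mk J)).IsPermissible) :
    ((I.map φ').map (Ideal.Quotient.mk (J.map φ'))).IsPermissible := by
  subst hφ
  have key : (I.map (Ideal.Quotient.mk J)).map
      ((Ideal.quotientEquiv J (J.map (φ : R →+* S)) φ rfl : R ⧸ J →+* S ⧸ J.map (φ : R →+* S))) =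
      (I.map (φ : R →+* S)).map (Ideal.Quotient.mk (J.map (φ : R →+* S))) := by
    rw [Ideal.map_map, Ideal.map_map]
    congr 1
  rw [← key]
  exact h.map_ringEquiv _

/-- **Non-regularity of `R/J` travels along a ring isomorphism** (to `S/φ(J)`). [folklore] -/
theorem not_isRegularLocalRing_quotient_of_ringEquiv {R S : Type u} [CommRing R] [CommRing S] (φ : R ≃+* S) {φ' : R →+* S}
    (hφ : (φ : R →+* S) = φ') {J : Ideal R} (h : ¬ IsRegularLocalRing (R ⧸ J)) :
    ¬ IsRegularLocalRing (S ⧸ J.map φ') := fun h' => by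
  subst hφ
  haveI := h'
  exact h (IsRegularLocalRing.of_ringEquiv (Ideal.quotientEquiv J (J.map (φ : R →+* S)) φ rfl).symm)

/-! ## §2 Along a morphism whose stalk map at the point is an isomorphism -/

section StalkIso

variable {E Z : Scheme.{u}} (f : E ⟶ Z) (x : E) [IsIso (f.stalkMap x)]

/-- **CJS permissibility travels along a stalk isomorphism**, for the pulled-back centre and the pulled-back strict transform ideal.
[cite: CossartJannsenSaito2020, Def. 3.1 (2)] -/
theorem isPermissible_stalk_comap (K 𝓓 : Z.IdealSheafData)
    (h : ((stalkIdeal K (f x)).map (Ideal.Quotient.mk (stalkIdeal 𝓓 (f x)))).IsPermissible) :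
    ((stalkIdeal (K.comap f) x).map (Ideal.Quotient.mk (stalkIdeal (𝓓.comap f) x))).IsPermissible := by
  rw [stalkIdeal_comap_eq_map, stalkIdeal_comap_eq_map]
  exact isPermissible_map_quotient_of_ringEquiv (asIso (f.stalkMap x)).commRingCatIsoToRingEquiv rfl h

/-- **Non-regularity of the local ring of the strict transform travels along a stalk isomorphism.** [folklore] -/
theorem not_isRegularLocalRing_stalk_comap (𝓓 : Z.IdealSheafData)
    (h : ¬ IsRegularLocalRing ((Z.presheaf.stalk (f x)) ⧸ stalkIdeal 𝓓 (f x))) :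
    ¬ IsRegularLocalRing ((E.presheaf.stalk x) ⧸ stalkIdeal (𝓓.comap f) x) := by
  rw [stalkIdeal_comap_eq_map]
  exact not_isRegularLocalRing_quotient_of_ringEquiv (asIso (f.stalkMap x)).commRingCatIsoToRingEquiv rfl h

end StalkIso

/-! ## §3 Off the centre of a blowing up: ideals of closed sets upstairs are pull-backs -/

section OffCentre

variable {E E' : Scheme.{u}} {τ : E' ⟶ E} {C : E.IdealSheafData}

/-- The open of the blow-up over the complement of the centre. [folklore] -/
theorem mem_preimage_compl_support (x' : E') (hx' : τ x' ∉ (C.support : Set E)) :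
    x' ∈ τ ⁻¹ᵁ (⟨(C.support : Set E)ᶜ, C.support.isClosed.isOpen_compl⟩ : E.Opens) := hx'

/-- Over the complement of its centre a blowing up is an open immersion (it is an isomorphism there, GW Prop. 13.91 (3)).
[cite: GortzWedhorn2020, Prop. 13.91 (3)] -/
theorem isOpenImmersion_ι_comp_of_isBlowup (hτ : IsBlowup τ C) :
    IsOpenImmersion ((τ ⁻¹ᵁ (⟨(C.support : Set E)ᶜ, C.support.isClosed.isOpen_compl⟩ : E.Opens)).ι ≫ τ) := by
  set W₀ : E.Opens := ⟨(C.support : Set E)ᶜ, C.support.isClosed.isOpen_compl⟩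
  haveI : IsIso (τ ∣_ W₀) := hτ.isIso_compl
  rw [← morphismRestrict_ι]
  infer_instance

/-- **Off the exceptional locus the ideal of a closed set is the pull-back**: for a blowing up `τ` along `C`, a point `x′` with
`τ x′ ∉ V(C)`, and closed `T ⊆ E`, `T′ ⊆ E′` agreeing off `τ⁻¹V(C)` (`T′ ∖ τ⁻¹V(C) = τ⁻¹(T ∖ V(C))`):
`𝓘(T′)_{x′} = (τ^*𝓘(T))_{x′}`. [cite: GortzWedhorn2020, Prop. 13.91 (3)] -/
theorem stalkIdeal_vanishingIdeal_eq_comap_of_not_mem (hτ : IsBlowup τ C) {x' : E'} (hx' : τ x' ∉ (C.support : Set E))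
    (T : Closeds E) (T' : Closeds E')
    (hT : (T' : Set E') \ τ ⁻¹' (C.support : Set E) = τ ⁻¹' ((T : Set E) \ (C.support : Set E))) :
    stalkIdeal (vanishingIdeal T') x' = stalkIdeal ((vanishingIdeal T).comap τ) x' := by
  set W₀ : E.Opens := ⟨(C.support : Set E)ᶜ, C.support.isClosed.isOpen_compl⟩ with hW₀
  set U' : E'.Opens := τ ⁻¹ᵁ W₀ with hU'
  haveI hoi : IsOpenImmersion (U'.ι ≫ τ) := isOpenImmersion_ι_comp_of_isBlowup hτ
  obtain ⟨u, rfl⟩ : x' ∈ Set.range U'.ι.base := by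
    rw [Scheme.Opens.range_ι]; exact mem_preimage_compl_support x' hx'
  -- both ideals restrict on `U'` to the ideal of the same closed subset of `U'`
  have h1 : (vanishingIdeal T').comap U'.ι = vanishingIdeal (T'.preimage U'.ι.continuous) :=
    comap_vanishingIdeal_of_isOpenImmersion U'.ι T'
  have h2 : ((vanishingIdeal T).comap τ).comap U'.ι = vanishingIdeal (T.preimage (U'.ι ≫ τ).continuous) := by
    rw [← Scheme.IdealSheafData.comap_comp]
    exact comap_vanishingIdeal_of_isOpenImmersion (U'.ι ≫ τ) T
  have h3 : T'.preimage U'.ι.continuous = T.preimage (U'.ι ≫ τ).continuous := by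
    ext v
    simp only [Closeds.coe_preimage, Set.mem_preimage]
    have hv : τ (U'.ι v) ∉ (C.support : Set E) := by
      have := v.2
      exact this
    constructor
    · intro hvT'
      have h : U'.ι v ∈ (T' : Set E') \ τ ⁻¹' (C.support : Set E) := ⟨hvT', hv⟩
      rw [hT] at h
      rw [Scheme.Hom.comp_apply]
      exact h.1
    · intro hvT
      rw [Scheme.Hom.comp_apply] at hvT
      have h : U'.ι v ∈ τ ⁻¹' ((T : Set E) \ (C.support : Set E)) := ⟨hvT, hv⟩
      rw [← hT] at h
      exact h.1
  have h4 : (vanishingIdeal T').comap U'.ι = ((vanishingIdeal T).comap τ).comap U'.ι := by rw [h1, h2, h3]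
  have h5 := (stalkIdeal_comap_eq_iff_of_isIso_stalkMap U'.ι (vanishingIdeal T') ((vanishingIdeal T).comap τ) u).mp
    (by rw [h4])
  exact h5

end OffCentre

/-! ## §4 The closure calculus of iterated strict transforms -/

section ClosureCalculus

variable {E E' : Scheme.{u}} {τ : E' ⟶ E} {C : E.IdealSheafData}

/-- **`τ⁻¹(cl A ∖ V(C)) ⊆ cl τ⁻¹(A ∖ V(C))`** for a blowing up `τ` along `C` (an open immersion over the complement of
`V(C)`, where preimages of closures are closures of preimages). [cite: GortzWedhorn2020, Prop. 13.91 (3)] -/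
theorem preimage_closure_diff_subset (hτ : IsBlowup τ C) (A : Set E) :
    τ ⁻¹' (closure A \ (C.support : Set E)) ⊆ closure (τ ⁻¹' (A \ (C.support : Set E))) := by
  set W₀ : E.Opens := ⟨(C.support : Set E)ᶜ, C.support.isClosed.isOpen_compl⟩ with hW₀
  set U' : E'.Opens := τ ⁻¹ᵁ W₀ with hU'
  haveI hoi : IsOpenImmersion (U'.ι ≫ τ) := isOpenImmersion_ι_comp_of_isBlowup hτ
  intro x' hx'
  obtain ⟨hxA, hxC⟩ := hx'
  obtain ⟨u, rfl⟩ : x' ∈ Set.range U'.ι.base := by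
    rw [Scheme.Opens.range_ι]; exact mem_preimage_compl_support x' hxC
  -- `τ x' ∈ cl A ∩ W₀ ⊆ cl (A ∩ W₀)`; pull back along the open immersion `U' → E`, push along `U' ↪ E'`
  have h1 : (U'.ι ≫ τ) u ∈ closure (A ∩ (W₀ : Set E)) := by
    rw [Scheme.Hom.comp_apply]
    exact W₀.2.closure_inter ⟨hxA, hxC⟩
  have hopen : IsOpenMap (U'.ι ≫ τ).base := (U'.ι ≫ τ).isOpenEmbedding.isOpenMap
  have h2 : u ∈ closure ((U'.ι ≫ τ) ⁻¹' (A ∩ (W₀ : Set E))) := hopen.preimage_closure_subset_closure_preimage h1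
  have h3 : U'.ι u ∈ closure (U'.ι '' ((U'.ι ≫ τ) ⁻¹' (A ∩ (W₀ : Set E)))) :=
    image_closure_subset_closure_image U'.ι.continuous ⟨u, h2, rfl⟩
  refine closure_mono ?_ h3
  rintro _ ⟨v, hv, rfl⟩
  rw [Set.mem_preimage, Scheme.Hom.comp_apply] at hv
  exact ⟨hv.1, fun h => hv.2 h⟩

/-- **The closure calculus of iterated strict transforms**: `cl τ⁻¹(cl A ∖ V(C)) = cl τ⁻¹(A ∖ V(C))`.
[cite: GortzWedhorn2020, Prop. 13.91 (3)] -/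
theorem closure_preimage_closure_diff (hτ : IsBlowup τ C) (A : Set E) :
    closure (τ ⁻¹' (closure A \ (C.support : Set E))) = closure (τ ⁻¹' (A \ (C.support : Set E))) := by
  refine le_antisymm (closure_minimal (preimage_closure_diff_subset hτ A) isClosed_closure) (closure_mono ?_)
  exact Set.preimage_mono (Set.sdiff_subset_sdiff_left subset_closure)

end ClosureCalculus

end MultiHostCJS

end Summit.ResolutionOfSingularities.ResolutionOfSingularities.Theorems

end
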